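import Literature.MathematicalPhysics.QuantumFieldTheory.Balaban1983to89.B9Eq326DeltaAPeriodicLettersZd
import Literature.MathematicalPhysics.QuantumFieldTheory.Balaban1983to89.B9Eq321LandauProjectionZdPer
import Literature.MathematicalPhysics.QuantumFieldTheory.Balaban1983to89.B9Eq316AveragingTransposeZdLevelZero

/-!
# `Balaban1983to89.B9SupplySockB9P3ZdAllLettersZdPer` — [Balaban1985BackgroundPropagators] (3.26)–(3.27) ON THE TORUS `T_P` READ ON `ℤᵈ`: THE GENUINE
# FOUR-LETTER RECORD `opsAllZdPer` of the J-N06→N05 junction on the (β′-PERIODIC) road — `Δ_a(U₀) = D*D + Δ′(U₀) + D R^per(U₀) D* + Q*aQ(U₀)` with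
# dag-n06-w4's periodic Landau projection `projRPer` ((3.20)–(3.22) on `T_P`), dag-n06-w2's `Δ′ = DpZd` (3.10), this lineage's `Q*aQ = QQZdP` (3.16), and
# `Gop := G_𝔤^per = (Δ_a)⁻¹` on the periodic Hermitian carrier (`withGopZdHPer`) — together with: the `DRD*` letter preserves `E_𝔤^per(P)` and is a SQUARE
# on the period cell, `PerPreservingAt` and `LinearOnDomAt` for the record, the four-term split of `⟨A, Δ_a(U₀)A⟩_per`, and positivity ⟹ `RegularAtHPer`

statement-level skeleton of published theorems with citation tags; proofs where landed; nothing here is a claim about the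
Yang–Mills mass gap

`[Balaban1985BackgroundPropagators]` ("B9", CMP **99** (1985) 389–434): (3.10) p. 392, (3.16)–(3.17) p. 393, (3.20)–(3.22) p. 394 (*«R(U) … the orthogonal
projection onto Δ^η_U N(Q′)»*), (3.26)–(3.27) p. 395 (*«Δ_a = Δ + D R D* + Q*aQ … G(U) = (Δ_a↾Ω₀)⁻¹»*), Thm 3.11 p. 416.  `[Balaban1985RegularSpaces]` ("B8")
p. 77 (*«we admit the case when some domains Ω_j are equal to T_η»*), (1.7) p. 77, (1.31) p. 82, (1.55), (1.58) p. 86.  PDF held: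
`paper:balaban1985-cmp99-background-propagators` pp. 392–395, 416.

CITATION HEADER ∕ WHY THIS FILE (cell `pub-ymgap`, HUMAN RULING D-0062; node N06 = [B9]; seat `pub-ymgap-dag-n06-b` (g22), junction ∕ letter lineage).  The
(β′-PERIODIC) road (director-ym №217 ∕ plan PENS-217) needs N06's OBJECTS on `P`-periodic data with `Ω 0 = univ`.  In tree now: the periodic propagator
`B9Eq327GreenZdHermPer.gopZdHPer` + binder `InvAtHIPer` (this seat, p638598), the periodicity of `Δ′` ∕ `Q*aQ` (`B9Eq326DeltaAPeriodicLettersZd`, this seat),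
and dag-n06-w4 g5's periodic Landau projection `B9Eq321LandauProjectionZdPer.projEPer ∕ projRPer` (p639373; the RECORD twin handed back to this seat, bus
14:02Z).  THIS FILE assembles the genuine record on the torus — the periodic twin of `B9SupplySockB9P3ZdAllLettersZd.opsAllZd` (whose `opsLandau` letter is
`ops₀`'s junk at `Ω 0 = univ`, `B9Eq321LandauProjectionZd.opsLandau` `dif_neg`) — and proves the structural facts FILE 1's §4 asks of it, so that Theorem
3.11 on the torus (positivity of `⟨A, Δ_a(U₀)A⟩_per` on `E_𝔤^per(P) ∖ 0`) is the ONLY remaining input of `RegularAtHPer` ∕ `InvAtHIPer` for the genuine `G_𝔤^per`.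

WHAT IS DECLARED ∕ PROVED (kernel, 0 sorry; 2 `def` + theorems; no `instance`, no `notation`).
* §1 ★ `opsLandauPer τ P ops₀` (the record edit `DRDs := D^η_{U₀} · R^per(U₀) · D^{η*}_{U₀}` at every member, `R^per = projRPer τ P L m i.η (i.Λs m) U₀`;
  `Gop ∕ Dp ∕ QQ` untouched) · `opsLandauPer_DRDs ∕ _Gop ∕ _Dp ∕ _QQ` (rfl).
* §2 ★ `opsAllZdPer τ L P ΛbP ops₀ := withGopZdHPer P (opsLandauPer τ P (withDpZd (withQQP τ L ΛbP ops₀)))` · `opsAllZdPer_eq ∕ _Gop ∕ _Dp ∕ _DRDs ∕ _QQ` ·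
  `deltaAOf_opsAllZdPer` · ★ `gopAddAt_opsAllZdPer` (the binder `GopAddAt`, no hypothesis).
* §3 THE `DRD*` LETTER ON THE TORUS: `isSelfAdjoint_of_mem_rangeSubPer` (every element of `Δ^η_{U₀}N_𝔤^per(Q′)` is Hermitian-valued at a unitary `U₀`),
  ★ `projEPer_apply_isSelfAdjoint` ∕ `projRPer_isSelfAdjoint` (the projection LANDS in Hermitian-valued functions — for every input), `isPeriodic_projRPer`,
  ★★ `DRDs_mem_domSubHPer` (`D R^per D* A ∈ E_𝔤^per(P)` for EVERY bond field `A` at a periodic unitary `U₀`), `DRDsLinPer` ∕ `opsLandauPer_DRDs_eq_lin`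
  (ℝ-linearity).
* §4 ★★ `perPreservingAt_opsAllZdPer` (`L ≥ 2`, faithful Hermitian tracial `τ`, periodic unitary `U₀`, `Lᵐ ∣ P`, periodic class sections, (1.31) box law
  at `j ≥ 1` ⟹ `PerPreservingAt i.η (opsAllZdPer … M i m) P U₀`) · ★ `linearOnDomAt_opsAllZdPer_univ` (`LinearOnDomAt … univ U₀` from the four linear pieces;
  the `Q*aQ` piece = `qqLinearAt_withQQP₀`).
* §5 THE FORM ON THE CELL: `sum_dir_box_pair_covDerivFwd` (`Σ_μ Σ_cell B(A_μ, D^η_μ g) = Σ_cell B(D^{η*}A, g)` — FILE 1's cell adjointness summed over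
  directions), ★★ `bondPairPer_DRDs_eq_formPer_sq` (`⟨A, D R^per D* A⟩_per = ⟨R^per D*A, R^per D*A⟩_per` — the gauge-fixing term is a SQUARE on the torus),
  ★ `bondPairPer_DRDs_nonneg`, `bondPairPer_deltaAOf_opsAllZdPer_eq_four_terms`, ★ `bondPairPer_Jcur_add_DRDs_nonneg` (two of the four summands are `≥ 0`).
* §6 ★★ `regularAtHPer_opsAllZdPer_of_pos` (FILE 1 §4 instantiated: at a periodic unitary `U₀` with the §4 hypotheses, positivity of `⟨A, Δ_a(U₀)A⟩_per` on
  `E_𝔤^per(P) ∖ 0` ⟹ `RegularAtHPer i.η (opsLandauPer τ P (withDpZd (withQQP …)) M i m) P U₀`, i.e. `G_𝔤^per(U₀)` of `opsAllZdPer` inverts `Δ_a(U₀)`), ★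
  `regularAtHPer_opsAllZdPer_of_two_letters_pos` (enough: `⟨A, (Δ′ + Q*aQ)A⟩_per > −(the two squares)`, stated as positivity of the signed part plus squares).

HONEST SCOPE.  (i) Record assembly + structural bookkeeping; Theorem 3.11 on the torus (the positivity) is NOT proved — it is the displayed hypothesis of §6
(dag-n06-w3 g6's flat-kernel line and a continuity ∕ gauge step would inhabit it per member; member-UNIFORM constants = N06's node content).  (ii) The
`LandauAt`-type binder («`R^per(U₀)D^{η*}A = 0` for Landau `A`», the periodic twin of `B9Eq321LandauProjectionZd` §4) is NOT here (dag-n06-w4's successor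
pointer (2)).  (iii) At `P = 0` the definitions make sense but §3–§6 take `[NeZero P]`.  (iv) Count-neutral; N05 ∕ N06 NOT discharged; K1⁹
`stmt-QuantumFields-27364` NOT closed; 28∕28 · 5∕27 UNMOVED; one finite `𝕋⁴` programme at fixed `ε`, Bałaban as printed; R4 closes only the conditional
finite-`𝕋⁴` rung `BalabanLadder.UV` — nothing continuum ∕ ℝ⁴ ∕ OS ∕ mass gap ∕ Clay.  Unit `pub-ymgap-dag-n06-b` (g22), 2026-08-28.
-/

noncomputable section

namespace Literature.MathematicalPhysics.QuantumFieldTheory.Balaban1983to89.B9SupplySockB9P3ZdAllLettersZdPer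

open B7Prop1Explicit B7Eq78Linearization
open B7Prop2Explicit (unitaryUnits)
open B7Prop1Local (InBox loK bondHiK)
open B8Ineq132 (covDeriv covDerivFwd)
open B8Eq138LandauZd (covDivB covLap)
open B8Eq155JBound (Jcur)
open B8LeafModelZd (ZdIdx)
open B9SupplySockB9P3ZdLetters (OpsZd deltaAOf)
open B9SupplySockB9P3ZdAt (GopAddAt)
open B9SupplySockB9P3ZdGammaInAkDpZd (withDpZd)
open B9SupplySockB9P3ZdGenuineGop (QQLinearAt)
open B9Eq369CurvSmallZd (DpZd DpZd_add DpZd_smul)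
open B9Eq316AveragingTransposeZdPrinted (QQZdP withQQP)
open B9Eq316AveragingTransposeZdLevelZero (qqLinearAt_withQQP₀)
open B9Eq321LandauProjectionZd (star_covLap_of_isSelfAdjoint)
open B9Eq321LandauProjectionZdPer (perSub formPer perRestrict perRestrict_eq_self gaugeNullPer rangeSubPer projEPer projRPer isPeriodic_covDivB
  projEPer_apply_mem_range projEPer_isIdempotentElem formPer_projEPer_symm formPer_apply)
open B9Eq327GreenZd (LinearOnDomAt Jcur_smul_real)
open B9Eq327GreenZdHermPer (domSubHPer PerPreservingAt RegularAtHPer gopZdHPer withGopZdHPer bondPairPer mem_domSub_univ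
  regularAtHPer_of_bondPairPer_pos sum_box_pair_covDerivFwd sum_box_re_trace_Jcur_nonneg gopAddAt_withGopZdHPer)
open B9Eq326GaugeTermSquareZd (re_trace_star_pair_invariant)
open B9Eq326DeltaAPeriodicLettersZd (perPreservingAt_of_DpZd_QQZdP)
open T4TermwiseTorus (IsPeriodic box)

-- `Site` alone could resolve to the torus sites of `Setup.lean`; re-export the `ℤ^d` sites of `B7Prop1Explicit`.
export B7Prop1Explicit (Site)

variable {d : ℕ} {𝔸 : Type*} [CStarAlgebra 𝔸]

/-! ## §1  The record edit `opsLandauPer`: `DRDs := D^η_{U₀} R^per(U₀) D^{η*}_{U₀}` on the torus -/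

section Landau

variable (τ : 𝔸 →ₗ[ℂ] ℂ) (P : ℕ) {L : ℕ}

/-- ★ **THE LETTER FAMILY WITH THE GENUINE `DRD*` ON THE TORUS `T_P`**: `ops₀` with its `DRDs` field replaced, at every member `(M, i, m)`, by
`(DRDs U₀ A)(⟨x, x + e_μ⟩) := (D^η_{U₀,μ} R^per(U₀)(D^{η*}_{U₀}A))(x)` with `R^per(U₀) = projRPer τ P L m i.η (i.Λs m) U₀` dag-n06-w4's orthogonal projection
of (3.21)–(3.22) on `P`-periodic functions; `Gop ∕ Dp ∕ QQ` are `ops₀`'s letters.  The periodic twin of `B9Eq321LandauProjectionZd.opsLandau` (which at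
`Ω 0 = univ` falls back to `ops₀`). [cite: Balaban1985BackgroundPropagators, (3.26) p.395 («D^η_U R(U) D^{η*}_U»), (3.20)–(3.22) p.394; Balaban1985RegularSpaces, p.77 («Ω_j = T_η»)] -/
def opsLandauPer (ops₀ : ℝ → ZdIdx d L → ℕ → OpsZd d 𝔸) (M : ℝ) (i : ZdIdx d L) (m : ℕ) : OpsZd d 𝔸 where
  Gop := (ops₀ M i m).Gop
  Dp := (ops₀ M i m).Dp
  QQ := (ops₀ M i m).QQ
  DRDs := fun U₀ A x μ => covDerivFwd i.η U₀ μ (projRPer τ P L m i.η (i.Λs m) U₀ (covDivB i.η U₀ A)) x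

variable (ops₀ : ℝ → ZdIdx d L → ℕ → OpsZd d 𝔸) (M : ℝ) (i : ZdIdx d L) (m : ℕ)

/-- the `DRDs` letter, unfolded. [cite: Balaban1985BackgroundPropagators, (3.26) p.395 (bookkeeping)] -/
theorem opsLandauPer_DRDs (U₀ : Site d → Fin d → 𝔸ˣ) (A : Site d → Fin d → 𝔸) (x : Site d) (μ : Fin d) :
    (opsLandauPer τ P ops₀ M i m).DRDs U₀ A x μ = covDerivFwd i.η U₀ μ (projRPer τ P L m i.η (i.Λs m) U₀ (covDivB i.η U₀ A)) x := rfl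

/-- the `Gop` field is untouched. [cite: Balaban1985BackgroundPropagators, (3.27) p.395 (bookkeeping)] -/
theorem opsLandauPer_Gop : (opsLandauPer τ P ops₀ M i m).Gop = (ops₀ M i m).Gop := rfl

/-- the `Dp` field is untouched. [cite: Balaban1985BackgroundPropagators, (3.10) p.392 (bookkeeping)] -/
theorem opsLandauPer_Dp : (opsLandauPer τ P ops₀ M i m).Dp = (ops₀ M i m).Dp := rfl

/-- the `QQ` field is untouched. [cite: Balaban1985BackgroundPropagators, (3.16) p.393 (bookkeeping)] -/
theorem opsLandauPer_QQ : (opsLandauPer τ P ops₀ M i m).QQ = (ops₀ M i m).QQ := rfl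

end Landau

/-! ## §2  The genuine four-letter record on the torus `opsAllZdPer` -/

section Record

variable (τ : 𝔸 →ₗ[ℂ] ℂ) (L P : ℕ) [FiniteDimensional ℝ 𝔸]

/-- ★ **THE GENUINE FOUR-LETTER RECORD ON THE TORUS `T_P` READ ON `ℤᵈ`**: `Gop := G_𝔤^per = (Δ_a)⁻¹` on `E_𝔤^per(P)` (`withGopZdHPer`), `DRDs :=
D R^per(U₀) D*` (`opsLandauPer`), `Dp := Δ′(U₀)` (`withDpZd`, (3.10)), `QQ := Q*aQ(U₀)` EDITION P (`withQQP`, (3.16)) — every letter of (3.26)–(3.27) an OBJECT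
at the periodic members `Ω 0 = univ` of the (β′-PERIODIC) road. [cite: Balaban1985BackgroundPropagators, (3.26)–(3.27) p.395, (3.10) p.392, (3.16) p.393, (3.20)–(3.22) p.394; Balaban1985RegularSpaces, (1.58) p.86, p.77 («Ω_j = T_η»)] -/
def opsAllZdPer (ΛbP : ℕ → ℕ → Set (Site d × Fin d)) (ops₀ : ℝ → ZdIdx d L → ℕ → OpsZd d 𝔸) : ℝ → ZdIdx d L → ℕ → OpsZd d 𝔸 :=
  withGopZdHPer P (opsLandauPer τ P (withDpZd (withQQP τ L ΛbP ops₀)))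

variable (ΛbP : ℕ → ℕ → Set (Site d × Fin d)) (ops₀ : ℝ → ZdIdx d L → ℕ → OpsZd d 𝔸) (M : ℝ) (i : ZdIdx d L) (m : ℕ)

/-- the record IS the four-fold composite. [cite: Balaban1985BackgroundPropagators, (3.26) p.395 (bookkeeping)] -/
theorem opsAllZdPer_eq : opsAllZdPer τ L P ΛbP ops₀ = withGopZdHPer P (opsLandauPer τ P (withDpZd (withQQP τ L ΛbP ops₀))) := rfl

/-- the `Dp` field is the genuine `Δ′`. [cite: Balaban1985BackgroundPropagators, (3.10) p.392] -/
theorem opsAllZdPer_Dp : (opsAllZdPer τ L P ΛbP ops₀ M i m).Dp = DpZd i.η := rfl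

/-- the `QQ` field is the genuine `Q*aQ` of EDITION P. [cite: Balaban1985BackgroundPropagators, (3.16) p.393] -/
theorem opsAllZdPer_QQ : (opsAllZdPer τ L P ΛbP ops₀ M i m).QQ = QQZdP τ L ΛbP i m := rfl

/-- the `DRDs` field is the genuine `D R^per(U₀) D*` on the torus. [cite: Balaban1985BackgroundPropagators, (3.26) p.395, (3.20)–(3.22) p.394] -/
theorem opsAllZdPer_DRDs (U₀ : Site d → Fin d → 𝔸ˣ) (A : Site d → Fin d → 𝔸) (x : Site d) (μ : Fin d) :
    (opsAllZdPer τ L P ΛbP ops₀ M i m).DRDs U₀ A x μ = covDerivFwd i.η U₀ μ (projRPer τ P L m i.η (i.Λs m) U₀ (covDivB i.η U₀ A)) x := rfl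

/-- the `Gop` field is `G_𝔤^per` built from the three genuine co-letters. [cite: Balaban1985BackgroundPropagators, (3.27) p.395] -/
theorem opsAllZdPer_Gop (U₀ : Site d → Fin d → 𝔸ˣ) (J : Site d → Fin d → 𝔸) :
    (opsAllZdPer τ L P ΛbP ops₀ M i m).Gop U₀ J = gopZdHPer i.η (opsLandauPer τ P (withDpZd (withQQP τ L ΛbP ops₀)) M i m) P U₀ J := rfl

/-- `Δ_a` of the record is `Δ_a` of the three-letter composite (it never reads `Gop`). [cite: Balaban1985BackgroundPropagators, (3.26) p.395] -/
theorem deltaAOf_opsAllZdPer (U₀ : Site d → Fin d → 𝔸ˣ) (A : Site d → Fin d → 𝔸) :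
    deltaAOf i.η (opsAllZdPer τ L P ΛbP ops₀ M i m) U₀ A = deltaAOf i.η (opsLandauPer τ P (withDpZd (withQQP τ L ΛbP ops₀)) M i m) U₀ A := rfl

/-- `Δ_a` of the record at a bond: `D*DA + Δ′A + D R^per D* A + Q*aQ A`. [cite: Balaban1985BackgroundPropagators, (3.26) p.395, (3.10) p.392] -/
theorem deltaAOf_opsAllZdPer_apply (U₀ : Site d → Fin d → 𝔸ˣ) (A : Site d → Fin d → 𝔸) (x : Site d) (μ : Fin d) :
    deltaAOf i.η (opsAllZdPer τ L P ΛbP ops₀ M i m) U₀ A x μ =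
      Jcur i.η U₀ A μ x + DpZd i.η U₀ A x μ + covDerivFwd i.η U₀ μ (projRPer τ P L m i.η (i.Λs m) U₀ (covDivB i.η U₀ A)) x +
        QQZdP τ L ΛbP i m U₀ A x μ := rfl

/-- ★ **THE BINDER `GopAddAt` HOLDS FOR THE RECORD AT EVERY MEMBER, WITH NO HYPOTHESIS.** [cite: Balaban1985BackgroundPropagators, (3.27) p.395] -/
theorem gopAddAt_opsAllZdPer : GopAddAt L (opsAllZdPer τ L P ΛbP ops₀) M i m :=
  gopAddAt_withGopZdHPer P (opsLandauPer τ P (withDpZd (withQQP τ L ΛbP ops₀))) M i m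

end Record

/-! ## §3  The `DRD*` letter on the torus maps every bond field into `E_𝔤^per(P)` at a periodic unitary background, and is linear -/

section DRDsLetter

variable {τ : 𝔸 →ₗ[ℂ] ℂ} {P L m : ℕ} {η : ℝ} {Λs : ℕ → Set (Site d)} {U₀ : Site d → Fin d → 𝔸ˣ}

/-- **EVERY ELEMENT OF `R = Δ^η_{U₀}N_𝔤^per(Q′(U₀))` IS HERMITIAN-VALUED** at a unitary background (generators `Δ^η_{U₀}λ` with `λ` Hermitian: w4's
`star_covLap_of_isSelfAdjoint`; the span over `ℝ` keeps it). [cite: Balaban1985BackgroundPropagators, (3.21) p.394, p.391 («hermitian matrices»)] -/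
theorem isSelfAdjoint_of_mem_rangeSubPer (hUu : ∀ (x : Site d) (κ : Fin d), U₀ x κ ∈ unitaryUnits 𝔸) {w : perSub (𝔸 := 𝔸) (d := d) P}
    (hw : w ∈ rangeSubPer P L m η Λs U₀) (x : Site d) : IsSelfAdjoint ((w : Site d → 𝔸) x) := by
  induction hw using Submodule.span_induction with
  | mem w hw =>
    obtain ⟨lam, hlam, hwlam⟩ := hw
    rw [hwlam]
    exact star_covLap_of_isSelfAdjoint η hUu hlam.1 x
  | zero => exact IsSelfAdjoint.zero _
  | add w₁ w₂ _ _ h₁ h₂ => rw [Submodule.coe_add, Pi.add_apply]; exact h₁.add h₂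
  | smul c w _ hw =>
    rw [Submodule.coe_smul, Pi.smul_apply, IsSelfAdjoint, star_smul, star_trivial, hw.star_eq]

variable (τ P L m η Λs U₀)

/-- ★ **`R^per(U₀)f` IS HERMITIAN-VALUED FOR EVERY `f`** (faithful Hermitian `τ`, `P ≠ 0`, f.d. fibre, unitary `U₀`): the projection lands in `R`.
[cite: Balaban1985BackgroundPropagators, (3.21)–(3.22) p.394, p.391] -/
theorem projEPer_apply_isSelfAdjoint [FiniteDimensional ℝ 𝔸] [NeZero P] (hτs : ∀ a : 𝔸, τ (star a) = starRingEnd ℂ (τ a))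
    (hτp : ∀ a : 𝔸, a ≠ 0 → 0 < (τ (star a * a)).re) (hUu : ∀ (x : Site d) (κ : Fin d), U₀ x κ ∈ unitaryUnits 𝔸)
    (f : perSub (𝔸 := 𝔸) (d := d) P) (x : Site d) : IsSelfAdjoint ((projEPer τ P L m η Λs U₀ f : Site d → 𝔸) x) :=
  isSelfAdjoint_of_mem_rangeSubPer hUu (projEPer_apply_mem_range L m η Λs U₀ hτs hτp f) x

/-- `R^per(U₀)f` read on `ℤᵈ` is Hermitian-valued for every `f`. [cite: Balaban1985BackgroundPropagators, (3.21)–(3.22) p.394, p.391] -/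
theorem projRPer_isSelfAdjoint [FiniteDimensional ℝ 𝔸] [NeZero P] (hτs : ∀ a : 𝔸, τ (star a) = starRingEnd ℂ (τ a))
    (hτp : ∀ a : 𝔸, a ≠ 0 → 0 < (τ (star a * a)).re) (hUu : ∀ (x : Site d) (κ : Fin d), U₀ x κ ∈ unitaryUnits 𝔸)
    (f : Site d → 𝔸) (x : Site d) : IsSelfAdjoint (projRPer τ P L m η Λs U₀ f x) :=
  projEPer_apply_isSelfAdjoint τ P L m η Λs U₀ hτs hτp hUu _ x

/-- `R^per(U₀)f` read on `ℤᵈ` is `P`-periodic for every `f` (it is an element of `L²(T_P, ·)`). [cite: Balaban1985BackgroundPropagators, (3.21) p.394; Balaban1985RegularSpaces, p.77] -/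
theorem isPeriodic_projRPer (f : Site d → 𝔸) : IsPeriodic P (projRPer τ P L m η Λs U₀ f) :=
  (projEPer τ P L m η Λs U₀ ⟨perRestrict P f, B9Eq321LandauProjectionZdPer.perRestrict_mem_perSub P f⟩).2

/-- **`R^per(U₀)` READ ON `ℤᵈ` IS ℝ-LINEAR.** [cite: Balaban1985BackgroundPropagators, (3.21) p.394 («an orthogonal projection»)] -/
def projRPerLin : (Site d → 𝔸) →ₗ[ℝ] (Site d → 𝔸) where
  toFun := projRPer τ P L m η Λs U₀
  map_add' f g := by
    have h : (⟨perRestrict P (f + g), B9Eq321LandauProjectionZdPer.perRestrict_mem_perSub P (f + g)⟩ : perSub (𝔸 := 𝔸) (d := d) P) =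
        ⟨perRestrict P f, B9Eq321LandauProjectionZdPer.perRestrict_mem_perSub P f⟩ +
          ⟨perRestrict P g, B9Eq321LandauProjectionZdPer.perRestrict_mem_perSub P g⟩ := by
      apply Subtype.ext; funext x; rfl
    show ((projEPer τ P L m η Λs U₀ _ : perSub (𝔸 := 𝔸) (d := d) P) : Site d → 𝔸) = _
    rw [h, map_add, Submodule.coe_add]
    rfl
  map_smul' c f := by
    have h : (⟨perRestrict P (c • f), B9Eq321LandauProjectionZdPer.perRestrict_mem_perSub P (c • f)⟩ : perSub (𝔸 := 𝔸) (d := d) P) =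
        c • ⟨perRestrict P f, B9Eq321LandauProjectionZdPer.perRestrict_mem_perSub P f⟩ := by
      apply Subtype.ext; funext x; rfl
    show ((projEPer τ P L m η Λs U₀ _ : perSub (𝔸 := 𝔸) (d := d) P) : Site d → 𝔸) = _
    rw [h, map_smul, Submodule.coe_smul]
    rfl

/-- `projRPerLin`, unfolded. [cite: Balaban1985BackgroundPropagators, (3.21) p.394 (bookkeeping)] -/
theorem projRPerLin_apply (f : Site d → 𝔸) : projRPerLin τ P L m η Λs U₀ f = projRPer τ P L m η Λs U₀ f := rfl

end DRDsLetter

section DRDsRecord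

variable (τ : 𝔸 →ₗ[ℂ] ℂ) (P : ℕ) {L : ℕ} {U₀ : Site d → Fin d → 𝔸ˣ}

/-- ★★ **THE `DRD*` LETTER OF THE TORUS RECORD MAPS EVERY BOND FIELD INTO `E_𝔤^per(P)`** at a periodic unitary background (`P ≠ 0`, faithful Hermitian `τ`,
f.d. fibre): `D^η_{U₀} R^per(U₀) D^{η*}_{U₀} A` is periodic (the projection lives on `T_P`; FILE 1's `isPeriodic_covDerivFwd`) and Hermitian-valued
(`projRPer_isSelfAdjoint` + `B8Prop5Reality.isSelfAdjoint_covDerivFwd`) — for EVERY `A`. [cite: Balaban1985BackgroundPropagators, (3.26) p.395, (3.20)–(3.22) p.394, p.391; Balaban1985RegularSpaces, p.77] -/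
theorem DRDs_mem_domSubHPer [FiniteDimensional ℝ 𝔸] [NeZero P] (hτs : ∀ a : 𝔸, τ (star a) = starRingEnd ℂ (τ a))
    (hτp : ∀ a : 𝔸, a ≠ 0 → 0 < (τ (star a * a)).re) (ops₀ : ℝ → ZdIdx d L → ℕ → OpsZd d 𝔸) (M : ℝ) (i : ZdIdx d L) (m : ℕ)
    (hUu : ∀ (x : Site d) (κ : Fin d), U₀ x κ ∈ unitaryUnits 𝔸) (hU : IsPeriodic P U₀) (A : Site d → Fin d → 𝔸) :
    (opsLandauPer τ P ops₀ M i m).DRDs U₀ A ∈ domSubHPer (d := d) (𝔸 := 𝔸) P := by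
  refine ⟨fun x n => ?_, fun y μ => ?_⟩
  · funext μ
    exact B9Eq327GreenZdHermPer.isPeriodic_covDerivFwd i.η hU μ (isPeriodic_projRPer τ P L m i.η (i.Λs m) U₀ _) x n
  · exact B8Prop5Reality.isSelfAdjoint_covDerivFwd hUu (projRPer_isSelfAdjoint τ P L m i.η (i.Λs m) U₀ hτs hτp hUu _) μ y

omit [CStarAlgebra 𝔸] in
/-- the forward covariant derivative is ℝ-homogeneous. [cite: Balaban1985RegularSpaces, (1.1) p.76 (bookkeeping)] -/
private theorem covDerivFwd_smul_real' {𝔸 : Type*} [NormedRing 𝔸] [NormedAlgebra ℂ 𝔸] (η' : ℝ) (V : Site d → Fin d → 𝔸ˣ) (μ : Fin d) (c : ℝ)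
    (F : Site d → 𝔸) (x : Site d) : covDerivFwd η' V μ (c • F) x = c • covDerivFwd η' V μ F x := by
  simp only [covDerivFwd, Pi.smul_apply, conjR_smul_real, ← smul_sub, smul_comm c]

/-- the backward covariant derivative is ℝ-homogeneous. [cite: Balaban1985RegularSpaces, (1.1) p.76 (bookkeeping)] -/
private theorem covDeriv_smul_real' (η' : ℝ) (V : Site d → Fin d → 𝔸ˣ) (ν : Fin d) (c : ℝ) (F : Site d → 𝔸) (x : Site d) :
    covDeriv η' V ν (c • F) x = c • covDeriv η' V ν F x := by
  simp only [covDeriv, Pi.smul_apply, conjR_smul_real, ← smul_sub, smul_comm c]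

/-- the covariant divergence is ℝ-homogeneous in the bond field. [cite: Balaban1985RegularSpaces, (1.1) p.76 (bookkeeping)] -/
private theorem covDivB_smul_real' (η' : ℝ) (V : Site d → Fin d → 𝔸ˣ) (c : ℝ) (A : Site d → Fin d → 𝔸) (x : Site d) :
    covDivB η' V (c • A) x = c • covDivB η' V A x := by
  simp only [covDivB, Finset.smul_sum]
  refine Finset.sum_congr rfl fun μ _ => ?_
  have h : (fun z => (c • A) z μ) = c • fun z => A z μ := rfl
  rw [h, covDeriv_smul_real']

/-- **THE `DRD*` LETTER OF THE TORUS RECORD IS ℝ-LINEAR** in `A` (composition `D^η ∘ R^per ∘ D^{η*}` of linear maps).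
[cite: Balaban1985BackgroundPropagators, (3.26) p.395, (3.21) p.394] -/
def DRDsLinPer (ops₀ : ℝ → ZdIdx d L → ℕ → OpsZd d 𝔸) (M : ℝ) (i : ZdIdx d L) (m : ℕ) (U₀ : Site d → Fin d → 𝔸ˣ) :
    (Site d → Fin d → 𝔸) →ₗ[ℝ] (Site d → Fin d → 𝔸) where
  toFun A := (opsLandauPer τ P ops₀ M i m).DRDs U₀ A
  map_add' A B := by
    funext x μ
    rw [Pi.add_apply, Pi.add_apply, opsLandauPer_DRDs, opsLandauPer_DRDs, opsLandauPer_DRDs]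
    have hdiv : covDivB i.η U₀ (A + B) = covDivB i.η U₀ A + covDivB i.η U₀ B :=
      funext fun y => B9SupplySockB9P3ZdLettersOmega.covDivB_add i.η U₀ A B y
    rw [hdiv, ← projRPerLin_apply, map_add, B8LambdaSpaceKLevel.covDerivFwd_add']
    rfl
  map_smul' c A := by
    funext x μ
    rw [Pi.smul_apply, Pi.smul_apply, RingHom.id_apply, opsLandauPer_DRDs, opsLandauPer_DRDs]
    have hdiv : covDivB i.η U₀ (c • A) = c • covDivB i.η U₀ A := funext fun y => covDivB_smul_real' i.η U₀ c A y
    rw [hdiv, ← projRPerLin_apply, map_smul, projRPerLin_apply, covDerivFwd_smul_real']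

/-- the letter IS the linear map. [cite: Balaban1985BackgroundPropagators, (3.26) p.395 (bookkeeping)] -/
theorem DRDsLinPer_apply (ops₀ : ℝ → ZdIdx d L → ℕ → OpsZd d 𝔸) (M : ℝ) (i : ZdIdx d L) (m : ℕ) (U₀ : Site d → Fin d → 𝔸ˣ)
    (A : Site d → Fin d → 𝔸) : DRDsLinPer τ P ops₀ M i m U₀ A = (opsLandauPer τ P ops₀ M i m).DRDs U₀ A := rfl

end DRDsRecord

/-! ## §4  `PerPreservingAt` and `LinearOnDomAt` for the torus record -/

section Structural

variable (τ : 𝔸 →ₗ[ℂ] ℂ) {L : ℕ} (P : ℕ) [Nontrivial 𝔸] [FiniteDimensional ℝ 𝔸] [NeZero P]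

/-- ★★ **THE TORUS RECORD PRESERVES `E_𝔤^per(P)`** at every periodic unitary background of a periodic member: `L ≥ 2`, faithful Hermitian tracial `τ`,
`Lᵐ ∣ P`, the level-`j` class with `(P ∕ Lʲ)`-periodic sections, and [B8] (1.31)'s box law at `j ≥ 1` ⟹ `PerPreservingAt i.η (opsAllZdPer … M i m) P U₀` —
FILE 2's `perPreservingAt_of_DpZd_QQZdP` with the `DRD*` slot discharged by §3. [cite: Balaban1985BackgroundPropagators, (3.26) p.395, (3.10) p.392, (3.16) p.393, (3.20)–(3.22) p.394; Balaban1985RegularSpaces, (1.31) p.82, p.77 («Ω_j = T_η»)] -/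
theorem perPreservingAt_opsAllZdPer (hL : 2 ≤ L) (hτp : ∀ a : 𝔸, a ≠ 0 → 0 < (τ (star a * a)).re)
    (hτt : ∀ a b : 𝔸, τ (a * b) = τ (b * a)) (hτs : ∀ a : 𝔸, τ (star a) = starRingEnd ℂ (τ a))
    (ΛbP : ℕ → ℕ → Set (Site d × Fin d)) (ops₀ : ℝ → ZdIdx d L → ℕ → OpsZd d 𝔸) (M : ℝ) (i : ZdIdx d L) {m : ℕ}
    {U₀ : Site d → Fin d → 𝔸ˣ} (hUu : ∀ (x : Site d) (κ : Fin d), U₀ x κ ∈ unitaryUnits 𝔸) (hU : IsPeriodic P U₀) (hdvd : L ^ m ∣ P)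
    (hΛ : ∀ j, j ≤ m → ∀ κ : Fin d, IsPeriodic (P / L ^ j) (fun z => (z, κ) ∈ ΛbP m j))
    (hbox : ∀ j, 1 ≤ j → j ≤ m → ∀ c ∈ ΛbP m j, ∀ x, InBox (loK L j c.1) (bondHiK L j c.1 c.2) x → x ∈ i.Ω (j - 1)) :
    PerPreservingAt i.η (opsAllZdPer τ L P ΛbP ops₀ M i m) P U₀ :=
  perPreservingAt_of_DpZd_QQZdP τ hL hτp hτt hτs ΛbP i (opsLandauPer τ P (withDpZd (withQQP τ L ΛbP ops₀)) M i m) rfl rfl hUu hU hdvd hΛ hbox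
    fun A _ => DRDs_mem_domSubHPer τ P hτs hτp (withDpZd (withQQP τ L ΛbP ops₀)) M i m hUu hU A

omit [NeZero P] in
/-- ★ **`Δ_a(U₀)` OF THE TORUS RECORD IS ℝ-LINEAR ON ALL BOND FIELDS** (`LinearOnDomAt` at `Ω₀ = ℤᵈ`): `D*D` (`Jcur_add ∕ Jcur_smul_real`), `Δ′` (`DpZd_add ∕
_smul`), `D R^per D*` (§3) and `Q*aQ` EDITION P under the box law at a unitary `U₀` (`qqLinearAt_withQQP₀`) are linear.
[cite: Balaban1985BackgroundPropagators, (3.26) p.395 (Δ_a is a linear operator)] -/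
theorem linearOnDomAt_opsAllZdPer_univ (hL : 2 ≤ L) (ΛbP : ℕ → ℕ → Set (Site d × Fin d)) (ops₀ : ℝ → ZdIdx d L → ℕ → OpsZd d 𝔸) (M : ℝ)
    (i : ZdIdx d L) (m : ℕ)
    (hbox : ∀ j, 1 ≤ j → j ≤ m → ∀ c ∈ ΛbP m j, ∀ x, InBox (loK L j c.1) (bondHiK L j c.1 c.2) x → x ∈ i.Ω (j - 1))
    {U₀ : Site d → Fin d → 𝔸ˣ} (hUu : ∀ (x : Site d) (κ : Fin d), U₀ x κ ∈ unitaryUnits 𝔸) :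
    LinearOnDomAt i.η (opsAllZdPer τ L P ΛbP ops₀ M i m) (Set.univ : Set (Site d)) U₀ := by
  obtain ⟨Tq, hTq⟩ := qqLinearAt_withQQP₀ τ L hL ΛbP ops₀ M i m hbox hUu
  let TJ : (Site d → Fin d → 𝔸) →ₗ[ℝ] (Site d → Fin d → 𝔸) :=
    { toFun := fun A x μ => Jcur i.η U₀ A μ x
      map_add' := fun A B => by
        funext x μ
        exact B9SupplySockB9P3ZdLettersOmega.Jcur_add i.η U₀ A B μ x
      map_smul' := fun c A => by
        funext x μ
        exact Jcur_smul_real i.η U₀ c A μ x }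
  let TD : (Site d → Fin d → 𝔸) →ₗ[ℝ] (Site d → Fin d → 𝔸) :=
    { toFun := fun A => DpZd i.η U₀ A
      map_add' := fun A B => DpZd_add i.η U₀ A B
      map_smul' := fun c A => by
        rw [RingHom.id_apply, ← Complex.coe_smul, DpZd_smul, Complex.coe_smul] }
  refine ⟨TJ + TD + DRDsLinPer τ P (withDpZd (withQQP τ L ΛbP ops₀)) M i m U₀ + Tq, fun A _ => ?_⟩
  funext x μ
  simp only [LinearMap.add_apply, Pi.add_apply, hTq A, DRDsLinPer_apply]
  rfl

end Structural

/-! ## §5  The form on the period cell: the gauge-fixing term is a square; two of the four summands of `⟨A, Δ_a(U₀)A⟩_per` are non-negative -/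

section Form

variable {V : Type*} [AddCommGroup V] [Module ℝ V]
variable (B : 𝔸 →ₗ[ℝ] 𝔸 →ₗ[ℝ] V) (S : Subgroup 𝔸ˣ) (P : ℕ) (η : ℝ) (U₀ : Site d → Fin d → 𝔸ˣ)

/-- **`D^{η*}_{U₀}` IS THE `B`-TRANSPOSE OF `D^η_{U₀}` ON BOND FIELDS OVER THE CELL**, summed over the directions: for a periodic background with bond
variables in `S`, a periodic bond field `A` and a periodic `g`, `Σ_μ Σ_cell B(A_μ(x), (D^η_{U₀,μ}g)(x)) = Σ_cell B((D^{η*}_{U₀}A)(x), g(x))` (FILE 1's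
`sum_box_pair_covDerivFwd` direction by direction; `covDivB = Σ_μ covDeriv_μ`). [cite: Balaban1985RegularSpaces, (1.1)–(1.2) p.76; Balaban1985BackgroundPropagators, (3.23) p.394, p.391 (the adjoints)] -/
theorem sum_dir_box_pair_covDerivFwd [NeZero P] (hB : ∀ u ∈ S, ∀ a b : 𝔸, B (conjR u a) b = B a (conjR u⁻¹ b))
    (hUS : ∀ (x : Site d) (κ : Fin d), U₀ x κ ∈ S) (hU : IsPeriodic P U₀) {A : Site d → Fin d → 𝔸} (hA : IsPeriodic P A) {g : Site d → 𝔸}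
    (hg : IsPeriodic P g) :
    ∑ μ : Fin d, ∑ x ∈ box (d := d) P, B (A x μ) (covDerivFwd η U₀ μ g x) = ∑ x ∈ box (d := d) P, B (covDivB η U₀ A x) (g x) := by
  have hdir : ∀ μ : Fin d, ∑ x ∈ box (d := d) P, B (A x μ) (covDerivFwd η U₀ μ g x) =
      ∑ x ∈ box (d := d) P, B (covDeriv η U₀ μ (fun z => A z μ) x) (g x) := fun μ =>
    sum_box_pair_covDerivFwd B S P η U₀ hB μ (fun x => hUS x μ) hU hg (B9Eq327GreenZdHermPer.isPeriodic_apply_dir hA μ)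
  simp only [hdir]
  rw [Finset.sum_comm]
  refine Finset.sum_congr rfl fun x _ => ?_
  rw [covDivB, map_sum, LinearMap.sum_apply]

variable (τ : 𝔸 →ₗ[ℂ] ℂ) {L : ℕ}

/-- ★★ **THE GAUGE-FIXING TERM IS A SQUARE ON THE TORUS**: for a faithful Hermitian tracial `τ` on a finite-dimensional fibre, a periodic unitary `U₀` and a
periodic bond field `A`, with `f = D^{η*}_{U₀}A ∈ L²(T_P, ·)` and `R^per = projEPer …`:
`⟨A, D R^per D* A⟩_per = Σ_μ Σ_cell Re τ(A(x,μ)* (D^η_{U₀,μ} R^per f)(x)) = ⟨R^per f, R^per f⟩_per` — adjointness of `D` on the cell, then `R = Rᵀ = R²`.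
[cite: Balaban1985BackgroundPropagators, (3.20) p.394 («‖RD*A‖²»), (3.26) p.395, (3.21)–(3.22) p.394; Balaban1985RegularSpaces, p.77] -/
theorem bondPairPer_DRDs_eq_formPer_sq [FiniteDimensional ℝ 𝔸] [NeZero P] (hτt : ∀ a b : 𝔸, τ (a * b) = τ (b * a))
    (hτs : ∀ a : 𝔸, τ (star a) = starRingEnd ℂ (τ a)) (hτp : ∀ a : 𝔸, a ≠ 0 → 0 < (τ (star a * a)).re)
    (ops₀ : ℝ → ZdIdx d L → ℕ → OpsZd d 𝔸) (M : ℝ) (i : ZdIdx d L) (m : ℕ)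
    {U₀ : Site d → Fin d → 𝔸ˣ} (hUu : ∀ (x : Site d) (κ : Fin d), U₀ x κ ∈ unitaryUnits 𝔸) (hU : IsPeriodic P U₀)
    {A : Site d → Fin d → 𝔸} (hA : IsPeriodic P A) :
    bondPairPer τ P A ((opsLandauPer τ P ops₀ M i m).DRDs U₀ A) =
      formPer τ P (projEPer τ P L m i.η (i.Λs m) U₀ ⟨covDivB i.η U₀ A, isPeriodic_covDivB hU hA⟩)
        (projEPer τ P L m i.η (i.Λs m) U₀ ⟨covDivB i.η U₀ A, isPeriodic_covDivB hU hA⟩) := by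
  set f : perSub (𝔸 := 𝔸) (d := d) P := ⟨covDivB i.η U₀ A, isPeriodic_covDivB hU hA⟩ with hf
  set R := projEPer τ P L m i.η (i.Λs m) U₀ with hR
  -- the real pairing `Re τ(a* b)` as a bilinear map, `Ad`-invariant under unitaries
  let Bτ : 𝔸 →ₗ[ℝ] 𝔸 →ₗ[ℝ] ℝ :=
    LinearMap.mk₂ ℝ (fun a b => (τ (star a * b)).re)
      (fun a₁ a₂ b => by rw [star_add, add_mul, map_add, Complex.add_re])
      (fun c a b => by
        rw [star_smul, star_trivial, smul_mul_assoc, ← Complex.coe_smul, map_smul, smul_eq_mul, smul_eq_mul, Complex.re_ofReal_mul])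
      (fun a b₁ b₂ => by rw [mul_add, map_add, Complex.add_re])
      (fun c a b => by rw [mul_smul_comm, ← Complex.coe_smul, map_smul, smul_eq_mul, smul_eq_mul, Complex.re_ofReal_mul])
  have hB : ∀ u ∈ unitaryUnits 𝔸, ∀ a b : 𝔸, Bτ (conjR u a) b = Bτ a (conjR u⁻¹ b) :=
    fun u hu a b => re_trace_star_pair_invariant τ hτt hu a b
  -- `projRPer f = R f` read on `ℤᵈ`, since `f` is periodic
  have hproj : projRPer τ P L m i.η (i.Λs m) U₀ (covDivB i.η U₀ A) = ((R f : perSub (𝔸 := 𝔸) (d := d) P) : Site d → 𝔸) := by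
    have h1 : (⟨perRestrict P (covDivB i.η U₀ A), B9Eq321LandauProjectionZdPer.perRestrict_mem_perSub P _⟩ : perSub (𝔸 := 𝔸) (d := d) P) = f := by
      apply Subtype.ext
      exact perRestrict_eq_self P (isPeriodic_covDivB hU hA)
    rw [projRPer, h1]
  have hRper : IsPeriodic P (((R f : perSub (𝔸 := 𝔸) (d := d) P)) : Site d → 𝔸) := (R f).2
  -- Step 1: the bond pairing as `Σ_μ Σ_cell Bτ(A_μ, D^η_μ (Rf))`, then adjointness on the cell
  have h1 : bondPairPer τ P A ((opsLandauPer τ P ops₀ M i m).DRDs U₀ A) =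
      ∑ x ∈ box (d := d) P, Bτ (covDivB i.η U₀ A x) (((R f : perSub (𝔸 := 𝔸) (d := d) P) : Site d → 𝔸) x) := by
    rw [bondPairPer, ← sum_dir_box_pair_covDerivFwd Bτ (unitaryUnits 𝔸) P i.η U₀ hB hUu hU hA hRper]
    refine Finset.sum_congr rfl fun μ _ => Finset.sum_congr rfl fun x _ => ?_
    rw [opsLandauPer_DRDs, hproj]
    rfl
  -- Step 2: `⟨f, Rf⟩ = ⟨Rf, Rf⟩` (`R` symmetric and idempotent)
  have h2 : ∑ x ∈ box (d := d) P, Bτ (covDivB i.η U₀ A x) (((R f : perSub (𝔸 := 𝔸) (d := d) P) : Site d → 𝔸) x) = formPer τ P f (R f) := by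
    rw [formPer_apply]
    rfl
  have h3 : formPer τ P f (R f) = formPer τ P (R f) (R f) := by
    have hidem : R (R f) = R f := by
      have h := projEPer_isIdempotentElem (P := P) (τ := τ) L m i.η (i.Λs m) U₀ hτs hτp
      rw [← hR] at h
      exact LinearMap.congr_fun h f
    have hsym := formPer_projEPer_symm L m i.η (i.Λs m) U₀ hτs hτp f (R f)
    rw [← hR, hidem] at hsym
    exact hsym.symm
  rw [h1, h2, h3]

/-- each diagonal term `Re τ(a* a)` is non-negative for a faithful positive trace. [folklore] -/
private theorem re_trace_star_mul_self_nonneg'' (hτp : ∀ a : 𝔸, a ≠ 0 → 0 < (τ (star a * a)).re) (a : 𝔸) : 0 ≤ (τ (star a * a)).re := by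
  by_cases ha : a = 0
  · rw [ha, mul_zero, map_zero, Complex.zero_re]
  · exact (hτp a ha).le

/-- ★ **`⟨A, D R^per D* A⟩_per ≥ 0`** (it is `‖R^per D*A‖²_per`). [cite: Balaban1985BackgroundPropagators, (3.20) p.394, (3.26) p.395] -/
theorem bondPairPer_DRDs_nonneg [FiniteDimensional ℝ 𝔸] [NeZero P] (hτt : ∀ a b : 𝔸, τ (a * b) = τ (b * a))
    (hτs : ∀ a : 𝔸, τ (star a) = starRingEnd ℂ (τ a)) (hτp : ∀ a : 𝔸, a ≠ 0 → 0 < (τ (star a * a)).re)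
    (ops₀ : ℝ → ZdIdx d L → ℕ → OpsZd d 𝔸) (M : ℝ) (i : ZdIdx d L) (m : ℕ)
    {U₀ : Site d → Fin d → 𝔸ˣ} (hUu : ∀ (x : Site d) (κ : Fin d), U₀ x κ ∈ unitaryUnits 𝔸) (hU : IsPeriodic P U₀)
    {A : Site d → Fin d → 𝔸} (hA : IsPeriodic P A) :
    0 ≤ bondPairPer τ P A ((opsLandauPer τ P ops₀ M i m).DRDs U₀ A) := by
  rw [bondPairPer_DRDs_eq_formPer_sq P τ hτt hτs hτp ops₀ M i m hUu hU hA, formPer_apply]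
  exact Finset.sum_nonneg fun x _ => re_trace_star_mul_self_nonneg'' τ hτp _

/-- **THE FOUR TERMS OF `⟨A, Δ_a(U₀)A⟩_per` FOR THE TORUS RECORD**: `⟨A, D*DA⟩_per + ⟨A, Δ′A⟩_per + ⟨A, D R^per D* A⟩_per + ⟨A, Q*aQ A⟩_per`.
[cite: Balaban1985BackgroundPropagators, (3.26) p.395, (3.10) p.392] -/
theorem bondPairPer_deltaAOf_opsAllZdPer_eq_four_terms [FiniteDimensional ℝ 𝔸] (ΛbP : ℕ → ℕ → Set (Site d × Fin d))
    (ops₀ : ℝ → ZdIdx d L → ℕ → OpsZd d 𝔸) (M : ℝ) (i : ZdIdx d L) (m : ℕ) (U₀ : Site d → Fin d → 𝔸ˣ) (A : Site d → Fin d → 𝔸) :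
    bondPairPer τ P A (deltaAOf i.η (opsAllZdPer τ L P ΛbP ops₀ M i m) U₀ A) =
      (∑ μ : Fin d, ∑ x ∈ box (d := d) P, (τ (star (A x μ) * Jcur i.η U₀ A μ x)).re) + bondPairPer τ P A (DpZd i.η U₀ A) +
        bondPairPer τ P A ((opsLandauPer τ P (withDpZd (withQQP τ L ΛbP ops₀)) M i m).DRDs U₀ A) + bondPairPer τ P A (QQZdP τ L ΛbP i m U₀ A) := by
  simp only [bondPairPer, ← Finset.sum_add_distrib]
  refine Finset.sum_congr rfl fun μ _ => Finset.sum_congr rfl fun x _ => ?_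
  rw [deltaAOf_opsAllZdPer_apply, opsLandauPer_DRDs]
  simp only [mul_add, map_add, Complex.add_re]

/-- ★ **TWO OF THE FOUR SUMMANDS ARE NON-NEGATIVE ON THE TORUS**: `⟨A, D*DA⟩_per + ⟨A, D R^per D* A⟩_per ≥ 0` at a periodic unitary background for a
periodic `A` (FILE 1's energy positivity + §5's square) — what Theorem 3.11's positivity on `T_P` must add is a bound on the signed part
`⟨A, Δ′A⟩_per + ⟨A, Q*aQ A⟩_per`. [cite: Balaban1985BackgroundPropagators, (3.10) p.392, (3.20) p.394, (3.26) p.395, Thm 3.11 p.416] -/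
theorem bondPairPer_Jcur_add_DRDs_nonneg [FiniteDimensional ℝ 𝔸] [NeZero P] (hτt : ∀ a b : 𝔸, τ (a * b) = τ (b * a))
    (hτs : ∀ a : 𝔸, τ (star a) = starRingEnd ℂ (τ a)) (hτp : ∀ a : 𝔸, a ≠ 0 → 0 < (τ (star a * a)).re)
    (ops₀ : ℝ → ZdIdx d L → ℕ → OpsZd d 𝔸) (M : ℝ) (i : ZdIdx d L) (m : ℕ)
    {U₀ : Site d → Fin d → 𝔸ˣ} (hUu : ∀ (x : Site d) (κ : Fin d), U₀ x κ ∈ unitaryUnits 𝔸) (hU : IsPeriodic P U₀)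
    {A : Site d → Fin d → 𝔸} (hA : IsPeriodic P A) :
    0 ≤ (∑ μ : Fin d, ∑ x ∈ box (d := d) P, (τ (star (A x μ) * Jcur i.η U₀ A μ x)).re) +
      bondPairPer τ P A ((opsLandauPer τ P ops₀ M i m).DRDs U₀ A) :=
  add_nonneg (sum_box_re_trace_Jcur_nonneg P i.η U₀ τ hτt hτp hUu hU hA) (bondPairPer_DRDs_nonneg P τ hτt hτs hτp ops₀ M i m hUu hU hA)

end Form

/-! ## §6  Positivity on the torus ⟹ `G_𝔤^per(U₀)` of the record inverts `Δ_a(U₀)` (`RegularAtHPer`) -/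

section Regular

variable (τ : 𝔸 →ₗ[ℂ] ℂ) {L : ℕ} (P : ℕ) [Nontrivial 𝔸] [FiniteDimensional ℝ 𝔸] [NeZero P]

/-- ★★ **THEOREM 3.11 ON THE TORUS ⟹ (3.27) EXISTS FOR THE GENUINE RECORD, AT ONE PERIODIC MEMBER AND BACKGROUND**: under the structural hypotheses of §4
(`L ≥ 2`, faithful Hermitian tracial `τ`, `Lᵐ ∣ P`, periodic class sections, box law at `j ≥ 1`), at a periodic unitary `U₀`, if `0 < ⟨A, Δ_a(U₀)A⟩_per` for
every `0 ≠ A ∈ E_𝔤^per(P)`, then `Δ_a(U₀)` of the torus record is invertible on `E_𝔤^per(P)` — so `opsAllZdPer`'s `Gop = G_𝔤^per(U₀)` satisfies (1.58)'s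
identity there (`B9Eq327GreenZdHermPer.gopZdHPer_apply_eq_of_regularAtHPer`). [cite: Balaban1985BackgroundPropagators, Thm 3.11 p.416, (3.26)–(3.27) p.395; Balaban1985RegularSpaces, (1.58) p.86, p.77 («Ω_j = T_η»)] -/
theorem regularAtHPer_opsAllZdPer_of_pos (hL : 2 ≤ L) (hτp : ∀ a : 𝔸, a ≠ 0 → 0 < (τ (star a * a)).re)
    (hτt : ∀ a b : 𝔸, τ (a * b) = τ (b * a)) (hτs : ∀ a : 𝔸, τ (star a) = starRingEnd ℂ (τ a))
    (ΛbP : ℕ → ℕ → Set (Site d × Fin d)) (ops₀ : ℝ → ZdIdx d L → ℕ → OpsZd d 𝔸) (M : ℝ) (i : ZdIdx d L) {m : ℕ}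
    {U₀ : Site d → Fin d → 𝔸ˣ} (hUu : ∀ (x : Site d) (κ : Fin d), U₀ x κ ∈ unitaryUnits 𝔸) (hU : IsPeriodic P U₀) (hdvd : L ^ m ∣ P)
    (hΛ : ∀ j, j ≤ m → ∀ κ : Fin d, IsPeriodic (P / L ^ j) (fun z => (z, κ) ∈ ΛbP m j))
    (hbox : ∀ j, 1 ≤ j → j ≤ m → ∀ c ∈ ΛbP m j, ∀ x, InBox (loK L j c.1) (bondHiK L j c.1 c.2) x → x ∈ i.Ω (j - 1))
    (hpos : ∀ A ∈ domSubHPer (d := d) (𝔸 := 𝔸) P, A ≠ 0 → 0 < bondPairPer τ P A (deltaAOf i.η (opsAllZdPer τ L P ΛbP ops₀ M i m) U₀ A)) :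
    RegularAtHPer i.η (opsLandauPer τ P (withDpZd (withQQP τ L ΛbP ops₀)) M i m) P U₀ :=
  regularAtHPer_of_bondPairPer_pos τ P (linearOnDomAt_opsAllZdPer_univ τ P hL ΛbP ops₀ M i m hbox hUu)
    (perPreservingAt_opsAllZdPer τ P hL hτp hτt hτs ΛbP ops₀ M i hUu hU hdvd hΛ hbox) hpos

/-- ★ **IT SUFFICES TO CONTROL THE SIGNED PART**: if `⟨A, Δ′(U₀)A⟩_per + ⟨A, Q*aQ(U₀)A⟩_per + (⟨A, D*DA⟩_per + ⟨A, D R^per D* A⟩_per) > 0` on `E_𝔤^per(P) ∖ 0`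
— in particular if the signed part is `> −(the two squares)` — then `RegularAtHPer` (the four-term split of §5). [cite: Balaban1985BackgroundPropagators, Thm 3.11 p.416, (3.26) p.395, (3.10) p.392] -/
theorem regularAtHPer_opsAllZdPer_of_two_letters_pos (hL : 2 ≤ L) (hτp : ∀ a : 𝔸, a ≠ 0 → 0 < (τ (star a * a)).re)
    (hτt : ∀ a b : 𝔸, τ (a * b) = τ (b * a)) (hτs : ∀ a : 𝔸, τ (star a) = starRingEnd ℂ (τ a))
    (ΛbP : ℕ → ℕ → Set (Site d × Fin d)) (ops₀ : ℝ → ZdIdx d L → ℕ → OpsZd d 𝔸) (M : ℝ) (i : ZdIdx d L) {m : ℕ}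
    {U₀ : Site d → Fin d → 𝔸ˣ} (hUu : ∀ (x : Site d) (κ : Fin d), U₀ x κ ∈ unitaryUnits 𝔸) (hU : IsPeriodic P U₀) (hdvd : L ^ m ∣ P)
    (hΛ : ∀ j, j ≤ m → ∀ κ : Fin d, IsPeriodic (P / L ^ j) (fun z => (z, κ) ∈ ΛbP m j))
    (hbox : ∀ j, 1 ≤ j → j ≤ m → ∀ c ∈ ΛbP m j, ∀ x, InBox (loK L j c.1) (bondHiK L j c.1 c.2) x → x ∈ i.Ω (j - 1))
    (hsigned : ∀ A ∈ domSubHPer (d := d) (𝔸 := 𝔸) P, A ≠ 0 →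
      0 < bondPairPer τ P A (DpZd i.η U₀ A) + bondPairPer τ P A (QQZdP τ L ΛbP i m U₀ A) +
        ((∑ μ : Fin d, ∑ x ∈ box (d := d) P, (τ (star (A x μ) * Jcur i.η U₀ A μ x)).re) +
          bondPairPer τ P A ((opsLandauPer τ P (withDpZd (withQQP τ L ΛbP ops₀)) M i m).DRDs U₀ A))) :
    RegularAtHPer i.η (opsLandauPer τ P (withDpZd (withQQP τ L ΛbP ops₀)) M i m) P U₀ := by
  refine regularAtHPer_opsAllZdPer_of_pos τ P hL hτp hτt hτs ΛbP ops₀ M i hUu hU hdvd hΛ hbox fun A hA hA0 => ?_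
  rw [bondPairPer_deltaAOf_opsAllZdPer_eq_four_terms P τ ΛbP ops₀ M i m U₀ A]
  have h := hsigned A hA hA0
  linarith

end Regular

end Literature.MathematicalPhysics.QuantumFieldTheory.Balaban1983to89.B9SupplySockB9P3ZdAllLettersZdPer

end
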